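import Literature.AnabelianGeometry.EtaleTheta.Discharge.Sec4Prop42Sub
import Literature.AnabelianGeometry.EtaleTheta.Discharge.Sec4Prop43iiHolds
import HarnessLib

/-!
# [EtTh] Prop. 4.2 (iv), sub-nodes L08 `BetaCompat`, U1 `ZetaB_unique`, U2 `ZetaA_unique_upto_mu`,
# L07′ `RootUnitTorsion` — PROVED for EVERY §4 setting (universal closures, law-free)

Mochizuki, *The étale theta function and its Frobenioid-theoretic manifestations*, Publ. RIMS **45**
(2009) [EtTh], §4, Proposition 4.2 (iv), statement PDF p.89 L1–12, proof p.90 L12–24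
[cite: MochizukiEtTh2009, Prop 4.2 p.89]; Definition 3.6 (ii)(a) p.77 («`Φ^{bs-fld}` is monoprime»).

PROOF-ONLY companion (abc-iut cell, block F, seat abc-iut-f-131; FACT-LIST rows F-2801 `BetaCompat`,
F-2802 `ZetaB_unique`, F-2803 `ZetaA_unique_upto_mu`, F-2804 `RootUnitTorsion` of the sub-DAG statements
file `Literature/AnabelianGeometry/EtaleTheta/Prop42Sub.lean`, abc-iut-w5-d134).  Nothing of that file, of
`BiKummer.lean` / `BiKummerRoots.lean` (abc-iut-L2-t3) or of the conditional theorems of record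
(`Discharge/Sec4Prop42Sub.lean`: `betaCompat_of`, `zetaB_unique_of`, `zetaA_unique_upto_mu_of`,
`rootUnitTorsion_of`, all modulo `hΦd` «`Φ` divisorial» [+ the birational dictionary for L07′];
`Discharge/Sec4Prop42SubLawFree.lean`: the same at the canonical vocabulary) is edited or restated; no
`def`, no named fact, no instance, no new hypothesis.  The unit lemma `TemperedFrobenioid.eq_one_of_isUnit_of_mul_eq`
of abc-iut-f-111 (`Discharge/Sec4Prop43iiHolds.lean`, p430175 — the same law-free observation for Prop. 4.3 (ii) /
Thm. 4.4 (iv)) is IMPORTED, not restated.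

WHAT IS PROVED.  The four rows hold for EVERY setting `S : BiKummerSetting X T D VD` — every base field,
every `Π^tp_X`, every Def. 3.6 (i) datum `T`, every base category `D`, EVERY (opaque) [FrdI] vocabulary
`VD` — and every transport `pullFrac`; i.e. their UNIVERSAL CLOSURES are theorems:
`betaCompat_holds`, `zetaB_unique_holds`, `zetaA_unique_upto_mu_holds`, `rootUnitTorsion_holds`.
The [FrdI] Thm. 5.2 (ii) law «`Φ` divisorial» used by the proofs of record is NOT needed, nor is the
birational dictionary of L07′.  Two observations replace them:

* (abc-iut-f-111's `TemperedFrobenioid.eq_one_of_isUnit_of_mul_eq`, imported) in EVERY tempered Frobenioid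
  (Def. 3.6 (ii)) a unit `x` of `Φ(A)` that fixes some element, `x · m = m`, is trivial: `x · m = m` gives
  `of(x) = 1 ∈ ℝ·Φ₀^cnst` in `(Φ^{ℝ-log})^gp(A)`, so `x` and `x⁻¹` lie in
  `Φ^{bs-fld}(A) = Φ(A) ×_{(Φ^{ℝ-log})^gp} (ℝ·Φ₀^cnst)`, which is MONOPRIME by Def. 3.6 (ii)(a), hence sharp ([FrdI] §0);
* (§1, `TemperedFrobenioid.eq_of_comp_eq_of_isUnit_div`) hence in the Frobenioid `C` of a tempered
  Frobenioid a morphism `s` with `Base(s)` an isomorphism (e.g. a pre-step) can be cancelled on the left,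
  `s ≫ ψ = s ≫ ψ' ⇒ ψ = ψ'`, as soon as `Div(ψ)`, `Div(ψ')` are UNITS of `Φ` (isomorphisms, isometries and
  their composites; f-111's `aut_eq_of_comp_eq` is the case `ψ, ψ'` automorphisms) — the form of «Frobenioids
  are always totally epimorphic» ([FrdI] Def. 1.3 (v)) that print's argument for L08/U1 uses, valid here
  without divisoriality (`B` is group-like by the structure field `isUnit_BΛ`, abc-iut-L2-t3 v2).

Then (§2): L08 and U1 are this cancellation along the pre-step `s'_N`; U2 reads the `Div`- and `u`-components
of `u ∘ α = α` (`α` an isometry of Frobenius degree `N`) to get `Div(u)^N = 1`, `u_u^N = 1`, whence `u^N = 1`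
by [FrdI] Thm. 5.2 (i) (a morphism is the data `(deg_Fr, Base, Div, u)`); L07′ composes L08 with the
denominator square and cancels the pre-step `s''_N` to get `u ∘ β = β`, `β` an isometry of degree `N`, and
concludes the same way — print's «for some `u ∈ μ_N(B_N)`» (p.89 L4) thus needs no comparison of fractions.

HONEST FRAMING: refereed pre-IUT material ([EtTh] 2009, [FrdI] 2008); the rows are intermediate statements
OF THE PRINTED PROOF of Prop. 4.2 (iv) as typed by the cell; typed ≠ proved for the remaining rows of the
sub-DAG (L05/L06); a FACT row is an assumption label; nothing here bears on or takes a side on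
[IUTchIII] Cor. 3.12.
-/

namespace Literature.AnabelianGeometry.EtaleTheta

open CategoryTheory Opposite Literature.AlgebraicGeometry.Frobenioids

universe u₀ v₀ u v w

/-! ## §1. Law-free cancellation in the Frobenioid of a tempered Frobenioid (Def. 3.6 (ii)) -/

namespace TemperedFrobenioid

variable {D₀ : Type u₀} [Category.{v₀} D₀] {V : FrdIMonoidStub.{w}}
  {T : RealifiedDivisorMonoids (D₀ := D₀) V} {D : Type u} [Category.{v} D]
  {VD : FrdICatStub.{u, v, w} D} (C₀ : TemperedFrobenioid T D VD)

/-- **Law-free left cancellation in the Frobenioid of a tempered Frobenioid** («totally epimorphic»,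
[FrdI] Def. 1.3 (v), in the form used by [EtTh] Prop. 4.2 (iv)): for `s : X → Y` with `Base(s)` an
isomorphism (e.g. a pre-step) and `ψ, ψ' : Y → Z` whose zero divisors are UNITS of `Φ(Base Y)` (e.g.
isomorphisms, isometries, composites of such), `ψ ∘ s = ψ' ∘ s` implies `ψ = ψ'`.  The `deg_Fr`-, `Base`- and
`u`-components cancel as in [FrdI] Thm. 5.2 (ii) (`B` group-like by `isUnit_BΛ`); for the `Div`-component,
`Base(s)^*Div(ψ) · Div(s)^d = Base(s)^*Div(ψ') · Div(s)^d` makes the unit `Base(s)^*(Div(ψ)·Div(ψ')⁻¹)` fix an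
element of `Φ(Base X)`, so it is trivial by abc-iut-f-111's `eq_one_of_isUnit_of_mul_eq`.
[cite: MochizukiFrdI2008, Thm. 5.2(ii) p.101] -/
theorem eq_of_comp_eq_of_isUnit_div {X Y Z : C₀.category} (s : X ⟶ Y)
    [IsIso (ModelFrobenioid.baseMap s)] {ψ ψ' : Y ⟶ Z} (e : s ≫ ψ = s ≫ ψ')
    (hψ : IsUnit (ModelFrobenioid.div ψ)) (hψ' : IsUnit (ModelFrobenioid.div ψ')) : ψ = ψ' := by
  haveI : IsCancelMul (C₀.ratFnFunctor.obj (op X.base)) :=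
    isIntegral_iff_isCancelMul.mp
      (C₀.isGroupLike_ratFnFunctor T.isUnit_BΛ X.base).isPreDivisorial.isIntegral
  have hdeg : ModelFrobenioid.degFr ψ * ModelFrobenioid.degFr s =
      ModelFrobenioid.degFr ψ' * ModelFrobenioid.degFr s := congrArg ModelFrobenioid.Hom.degFr e
  have hb : ModelFrobenioid.baseMap s ≫ ModelFrobenioid.baseMap ψ =
      ModelFrobenioid.baseMap s ≫ ModelFrobenioid.baseMap ψ' := congrArg ModelFrobenioid.Hom.base e
  have hdiv : pull C₀.divisorMonoid (ModelFrobenioid.baseMap s) (ModelFrobenioid.div ψ) *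
      ModelFrobenioid.div s ^ (ModelFrobenioid.degFr ψ : ℕ) =
        pull C₀.divisorMonoid (ModelFrobenioid.baseMap s) (ModelFrobenioid.div ψ') *
          ModelFrobenioid.div s ^ (ModelFrobenioid.degFr ψ' : ℕ) := congrArg ModelFrobenioid.Hom.div e
  have hun : pull C₀.ratFnFunctor (ModelFrobenioid.baseMap s) (ModelFrobenioid.unit ψ) *
      ModelFrobenioid.unit s ^ (ModelFrobenioid.degFr ψ : ℕ) =
        pull C₀.ratFnFunctor (ModelFrobenioid.baseMap s) (ModelFrobenioid.unit ψ') *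
          ModelFrobenioid.unit s ^ (ModelFrobenioid.degFr ψ' : ℕ) := congrArg ModelFrobenioid.Hom.unit e
  have hdeg' : ModelFrobenioid.degFr ψ = ModelFrobenioid.degFr ψ' := mul_right_cancel hdeg
  rw [hdeg'] at hdiv hun
  -- the `Div`-component: the unit `a · b'` (`a = Base(s)^*Div(ψ)`, `b'` an inverse of `a' = Base(s)^*Div(ψ')`)
  -- fixes `a' · Div(s)^d`, hence is trivial
  set a := pull C₀.divisorMonoid (ModelFrobenioid.baseMap s) (ModelFrobenioid.div ψ) with ha
  set a' := pull C₀.divisorMonoid (ModelFrobenioid.baseMap s) (ModelFrobenioid.div ψ') with ha'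
  have hau : IsUnit a := hψ.map _
  obtain ⟨b', hb'⟩ := (hψ'.map (pull C₀.divisorMonoid (ModelFrobenioid.baseMap s))).exists_right_inv
  have hfix : (a * b') * (a' * ModelFrobenioid.div s ^ (ModelFrobenioid.degFr ψ' : ℕ)) =
      a' * ModelFrobenioid.div s ^ (ModelFrobenioid.degFr ψ' : ℕ) := by
    calc (a * b') * (a' * ModelFrobenioid.div s ^ (ModelFrobenioid.degFr ψ' : ℕ))
        = (a' * b') * (a * ModelFrobenioid.div s ^ (ModelFrobenioid.degFr ψ' : ℕ)) := by
          ac_rfl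
      _ = a' * ModelFrobenioid.div s ^ (ModelFrobenioid.degFr ψ' : ℕ) := by rw [hb', one_mul, hdiv]
  have hab : a * b' = 1 :=
    C₀.eq_one_of_isUnit_of_mul_eq (op X.base) (hau.mul (IsUnit.of_mul_eq_one_right _ hb')) hfix
  have haa : a = a' := by
    calc a = a * (b' * a') := by rw [mul_comm b' a', hb', mul_one]
      _ = a' := by rw [← mul_assoc, hab, one_mul]
  exact ModelFrobenioid.hom_ext hdeg' ((cancel_epi (ModelFrobenioid.baseMap s)).mp hb)
    (PreFrobenioid.pull_injective (ModelFrobenioid.baseMap s) haa)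
    (PreFrobenioid.pull_injective (ModelFrobenioid.baseMap s) (mul_right_cancel hun))

/-- For `γ ∈ O^×(X)` (base-identity linear automorphisms): `Div(γⁿ) = Div(γ)ⁿ` (`Div` is multiplicative on
`O^×(X)` since `Base(γ) = id`, `deg_Fr = 1`). [cite: MochizukiFrdI2008, Thm. 5.2(i) p.100] -/
theorem div_pow_hom_of_mem_units {X : C₀.category} {γ : Aut X} (hγ : γ ∈ ModelFrobenioid.units X)
    (n : ℕ) : ModelFrobenioid.div (γ ^ n).hom = ModelFrobenioid.div γ.hom ^ n := by
  induction n with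
  | zero => rw [pow_zero, pow_zero]; rfl
  | succ n ih =>
    have hn : γ ^ n ∈ ModelFrobenioid.units X := pow_mem hγ n
    rw [pow_succ, pow_succ]
    change ModelFrobenioid.div (γ.hom ≫ (γ ^ n).hom) = _
    rw [ModelFrobenioid.div_comp, hγ.1, ModelFrobenioid.map_id_apply_Φ, hn.2, PNat.one_coe, pow_one, ih]

/-- For `γ ∈ O^×(X)`: `u_{γⁿ} = u_γⁿ` (the homomorphism `O^×(X) → B(X_D)^×`, [FrdI] Thm. 5.2 (ii)).
[cite: MochizukiFrdI2008, Thm. 5.2(ii) p.101] -/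
theorem unit_pow_hom_of_mem_units {X : C₀.category} {γ : Aut X} (hγ : γ ∈ ModelFrobenioid.units X)
    (n : ℕ) : ModelFrobenioid.unit (γ ^ n).hom = ModelFrobenioid.unit γ.hom ^ n := by
  have h := congrArg (fun x : (C₀.ratFnFunctor.obj (op X.base))ˣ => (x : C₀.ratFnFunctor.obj (op X.base)))
    (map_pow (ModelFrobenioid.unitsToRatFn X) ⟨γ, hγ⟩ n)
  simpa only [Units.val_pow_eq_pow_val, ModelFrobenioid.coe_unitsToRatFn, SubmonoidClass.coe_pow] using h

/-- An element `γ ∈ O^×(X)` with `Div(γ)ⁿ = 1` and `u_γⁿ = 1` satisfies `γⁿ = 1` (a morphism is the data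
`(deg_Fr, Base, Div, u)`, [FrdI] Thm. 5.2 (i)). [cite: MochizukiFrdI2008, Thm. 5.2(i) p.100] -/
theorem pow_eq_one_of_mem_units {X : C₀.category} {γ : Aut X} (hγ : γ ∈ ModelFrobenioid.units X)
    {n : ℕ} (hd : ModelFrobenioid.div γ.hom ^ n = 1) (hu : ModelFrobenioid.unit γ.hom ^ n = 1) :
    γ ^ n = 1 := by
  have hn : γ ^ n ∈ ModelFrobenioid.units X := pow_mem hγ n
  apply Iso.ext
  refine ModelFrobenioid.hom_ext ?_ ?_ ?_ ?_
  · rw [hn.2]; rfl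
  · rw [hn.1]; rfl
  · rw [C₀.div_pow_hom_of_mem_units hγ, hd]; rfl
  · rw [C₀.unit_pow_hom_of_mem_units hγ, hu]; rfl

end TemperedFrobenioid

/-! ## §2. The four sub-nodes of Prop. 4.2 (iv), for every §4 setting — the FACT-LIST rows' universal
closures, conclusions spelled with fully-qualified names -/

namespace BiKummerSetting

namespace Prop42Sub

variable {K : Type u₀} [Field K] {X : SemiGraphs.TemperedArithmeticGroup.{u₀} K} {D₀ : Type u₀}
  [Category.{v₀} D₀] {V : FrdIMonoidStub.{w}} {T : RealifiedDivisorMonoids (D₀ := D₀) V} {D : Type u}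
  [Category.{v} D] {VD : FrdICatStub.{u, v, w} D} (S : BiKummerSetting X T D VD)
  (pullFrac : ∀ {A A' : S.C} (_ : A' ⟶ A), S.biratUnits A → S.biratUnits A')

/-- **(iv)/L08 `BetaCompat` — PROVED for every setting** (F-2801): «`β = β̄ ∘ ζ_B`» (statement p.89 L8): both
complete the `s'_N`-square under `s' ∘ α = s' ∘ ᾱ ∘ ζ_A`, their zero divisors are units (`β` an isometry,
`β̄ ∘ ζ_B` an isometry after an isomorphism), and the pre-step `s'_N` cancels (law-free total epimorphicity,
`TemperedFrobenioid.eq_of_comp_eq_of_isUnit_div`). [cite: MochizukiEtTh2009, Prop 4.2 p.89] -/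
theorem betaCompat_holds :
    Literature.AnabelianGeometry.EtaleTheta.BiKummerSetting.Prop42Sub.BetaCompat S pullFrac := by
  intro B f P N R R' ζA ζB hα hnum
  haveI : IsIso (ModelFrobenioid.baseMap R.pair.num) := R.pair.isPreStep_num.2
  have e : R.pair.num ≫ ζB.hom ≫ R'.β = R.pair.num ≫ R.β :=
    calc R.pair.num ≫ ζB.hom ≫ R'.β = (ζA.hom ≫ R'.pair.num) ≫ R'.β := by rw [← Category.assoc, ← hnum]
      _ = ζA.hom ≫ R'.α ≫ P.num := by rw [Category.assoc, R'.comm_num]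
      _ = R.α ≫ P.num := by rw [← Category.assoc, hα]
      _ = R.pair.num ≫ R.β := R.comm_num.symm
  have hβ : ModelFrobenioid.div R.β = 1 := R.isIsometry.2.1
  have hβ' : ModelFrobenioid.div R'.β = 1 := R'.isIsometry.2.1
  refine S.tf.eq_of_comp_eq_of_isUnit_div R.pair.num e ?_ (by rw [hβ]; exact isUnit_one)
  rw [ModelFrobenioid.div_comp_pull, hβ', map_one, one_mul]
  exact (PreFrobenioid.isUnit_div_of_isIso S.F ζB.hom).pow _

/-- `BetaCompat` — `_holds` alias of `betaCompat_holds` above under the fact's exact name (appended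
2026-08-28, D-0026 bookkeeping: the proof term is the existing theorem of this file; no statement,
definition or attribute is edited; no new named fact; the ledger's debt table listed the fact
unproved). [cite: MochizukiEtTh2009, Prop 4.2 p.89] -/
theorem _root_.Literature.AnabelianGeometry.EtaleTheta.BiKummerSetting.Prop42Sub.BetaCompat_holds :
    Literature.AnabelianGeometry.EtaleTheta.BiKummerSetting.Prop42Sub.BetaCompat S pullFrac :=
  _root_.Literature.AnabelianGeometry.EtaleTheta.BiKummerSetting.Prop42Sub.betaCompat_holds (S := S) (pullFrac := pullFrac)

/-- **(iv)/U1 `ZetaB_unique` — PROVED for every setting** (F-2802): «`ζ_B` is uniquely determined by `ζ_A`»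
(p.89 L8–9): two isomorphisms completing the `s'_N`-square agree after the pre-step `s'_N`, whose
cancellation is law-free for isomorphisms. [cite: MochizukiEtTh2009, Prop 4.2 p.89] -/
theorem zetaB_unique_holds :
    Literature.AnabelianGeometry.EtaleTheta.BiKummerSetting.Prop42Sub.ZetaB_unique S pullFrac := by
  intro B f P N R R' ζA ζB ζB' h h'
  haveI : IsIso (ModelFrobenioid.baseMap R.pair.num) := R.pair.isPreStep_num.2
  exact Iso.ext (S.tf.eq_of_comp_eq_of_isUnit_div R.pair.num (h.symm.trans h')
    (PreFrobenioid.isUnit_div_of_isIso S.F ζB.hom) (PreFrobenioid.isUnit_div_of_isIso S.F ζB'.hom))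

/-- `ZetaB_unique` — `_holds` alias of `zetaB_unique_holds` above under the fact's exact name (appended
2026-08-28, D-0026 bookkeeping: the proof term is the existing theorem of this file; no statement,
definition or attribute is edited; no new named fact; the ledger's debt table listed the fact
unproved). [cite: MochizukiEtTh2009, Prop 4.2 p.89] -/
theorem _root_.Literature.AnabelianGeometry.EtaleTheta.BiKummerSetting.Prop42Sub.ZetaB_unique_holds :
    Literature.AnabelianGeometry.EtaleTheta.BiKummerSetting.Prop42Sub.ZetaB_unique S pullFrac :=
  _root_.Literature.AnabelianGeometry.EtaleTheta.BiKummerSetting.Prop42Sub.zetaB_unique_holds (S := S) (pullFrac := pullFrac)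

/-- **(iv)/U2 `ZetaA_unique_upto_mu` — PROVED for every setting** (F-2803): «`ζ_A` is uniquely determined by
`Ā'`, up to composition with an element of `μ_N(A_N)`» (p.89 L9–10): `u := ζ_A' ∘ ζ_A⁻¹ ∈ O^×(A_N)` (same
base), and `u ∘ α = α` with `α` an isometry of Frobenius degree `N` gives `Div(u)^N = 1` and `u_u^N = 1`
([FrdI] Thm. 5.2 (i) composition law), whence `u^N = 1`. [cite: MochizukiEtTh2009, Prop 4.2 p.89] -/
theorem zetaA_unique_upto_mu_holds :
    Literature.AnabelianGeometry.EtaleTheta.BiKummerSetting.Prop42Sub.ZetaA_unique_upto_mu S pullFrac := by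
  intro B f P N R R' ζA ζA' hζ hζ' hbs
  have hb : ModelFrobenioid.baseMap ζA'.hom = ModelFrobenioid.baseMap ζA.hom :=
    (congrArg Iso.hom hbs).symm
  set u : Aut R.AN := ζA' ≪≫ ζA.symm with hu_def
  have hu : u ∈ ModelFrobenioid.units R.AN := ModelFrobenioid.trans_symm_mem_units ζA' ζA hb
  have hcomp : u.hom ≫ R.α = R.α := by
    calc u.hom ≫ R.α = ζA'.hom ≫ ζA.inv ≫ R.α := by
          rw [hu_def, Iso.trans_hom, Iso.symm_hom, Category.assoc]
      _ = ζA'.hom ≫ ζA.inv ≫ ζA.hom ≫ R'.α := by rw [hζ]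
      _ = ζA'.hom ≫ R'.α := by rw [Iso.inv_hom_id_assoc]
      _ = R.α := hζ'
  haveI : IsCancelMul (S.tf.ratFnFunctor.obj (op R.AN.base)) :=
    isIntegral_iff_isCancelMul.mp
      (S.tf.isGroupLike_ratFnFunctor T.isUnit_BΛ R.AN.base).isPreDivisorial.isIntegral
  have hN : ModelFrobenioid.degFr R.α = N := R.isIsometry.2.2.1
  have hα : ModelFrobenioid.div R.α = 1 := R.isIsometry.1
  have hunit : ModelFrobenioid.unit u.hom ^ (N : ℕ) = 1 := by
    have h := congrArg ModelFrobenioid.unit hcomp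
    rw [ModelFrobenioid.unit_comp, hu.1, ModelFrobenioid.map_id_apply_B, hN] at h
    exact mul_left_cancel (h.trans (mul_one _).symm)
  have hdiv : ModelFrobenioid.div u.hom ^ (N : ℕ) = 1 := by
    have h := congrArg ModelFrobenioid.div hcomp
    rw [ModelFrobenioid.div_comp, hu.1, ModelFrobenioid.map_id_apply_Φ, hN, hα, one_mul] at h
    exact h
  have hpow : u ^ (N : ℕ) = 1 := S.tf.pow_eq_one_of_mem_units hu hdiv hunit
  refine ⟨⟨u, ⟨hu.1, hu.2⟩, hpow⟩, ?_⟩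
  change ζA' = (ζA' ≪≫ ζA.symm) ≪≫ ζA
  rw [Iso.trans_assoc, Iso.symm_self_id, Iso.trans_refl]

/-- `ZetaA_unique_upto_mu` — `_holds` alias of `zetaA_unique_upto_mu_holds` above under the fact's exact name (appended
2026-08-28, D-0026 bookkeeping: the proof term is the existing theorem of this file; no statement,
definition or attribute is edited; no new named fact; the ledger's debt table listed the fact
unproved). [cite: MochizukiEtTh2009, Prop 4.2 p.89] -/
theorem _root_.Literature.AnabelianGeometry.EtaleTheta.BiKummerSetting.Prop42Sub.ZetaA_unique_upto_mu_holds :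
    Literature.AnabelianGeometry.EtaleTheta.BiKummerSetting.Prop42Sub.ZetaA_unique_upto_mu S pullFrac :=
  _root_.Literature.AnabelianGeometry.EtaleTheta.BiKummerSetting.Prop42Sub.zetaA_unique_upto_mu_holds (S := S) (pullFrac := pullFrac)

/-- **(iv)/L07′ `RootUnitTorsion` — PROVED for every setting and every transport** (F-2804): the unit
`u ∈ O^×(B_N)` relating the two denominator squares is `N`-torsion («for some `u ∈ μ_N(B_N)`», p.89 L4).
From L08 (`β = β̄ ∘ ζ_B`) and the two denominator squares, `s''_N ≫ u ≫ β = s''_N ≫ β`; the pre-step `s''_N`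
cancels (law-free), so `u ∘ β = β` with `β` an isometry of Frobenius degree `N`, whence `Div(u)^N = 1`,
`u_u^N = 1`, `u^N = 1` — no birational dictionary is needed. [cite: MochizukiEtTh2009, Prop 4.2 p.89] -/
theorem rootUnitTorsion_holds :
    Literature.AnabelianGeometry.EtaleTheta.BiKummerSetting.Prop42Sub.RootUnitTorsion S pullFrac := by
  intro B f P N R R' ζA ζB u hu hζ hnum hden
  have hu' : u ∈ ModelFrobenioid.units R.BN := ⟨hu.1, hu.2⟩
  haveI : IsIso (ModelFrobenioid.baseMap R.pair.den) := R.pair.isPreStep_den.2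
  -- L08: `ζ_B ≫ β̄ = β`
  have hβc : ζB.hom ≫ R'.β = R.β := betaCompat_holds S pullFrac f P N R R' ζA ζB hζ hnum
  -- the denominator squares: `s''_N ≫ (u ≫ β) = s''_N ≫ β`
  have e : R.pair.den ≫ u.hom ≫ R.β = R.pair.den ≫ R.β :=
    calc R.pair.den ≫ u.hom ≫ R.β = ((R.pair.den ≫ u.hom) ≫ ζB.hom) ≫ R'.β := by
          rw [← hβc, Category.assoc, Category.assoc]
      _ = ζA.hom ≫ R'.pair.den ≫ R'.β := by rw [← hden, Category.assoc]
      _ = ζA.hom ≫ R'.α ≫ P.den := by rw [R'.comm_den]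
      _ = R.α ≫ P.den := by rw [← Category.assoc, hζ]
      _ = R.pair.den ≫ R.β := R.comm_den.symm
  have hβ : ModelFrobenioid.div R.β = 1 := R.isIsometry.2.1
  have hN : ModelFrobenioid.degFr R.β = N := R.isIsometry.2.2.2
  have hdu : IsUnit (ModelFrobenioid.div u.hom) := PreFrobenioid.isUnit_div_of_isIso S.F u.hom
  have huβ : u.hom ≫ R.β = R.β := by
    refine S.tf.eq_of_comp_eq_of_isUnit_div R.pair.den e ?_ (by rw [hβ]; exact isUnit_one)
    rw [ModelFrobenioid.div_comp_pull, hβ, map_one, one_mul]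
    exact hdu.pow _
  haveI : IsCancelMul (S.tf.ratFnFunctor.obj (op R.BN.base)) :=
    isIntegral_iff_isCancelMul.mp
      (S.tf.isGroupLike_ratFnFunctor T.isUnit_BΛ R.BN.base).isPreDivisorial.isIntegral
  have hunit : ModelFrobenioid.unit u.hom ^ (N : ℕ) = 1 := by
    have h := congrArg ModelFrobenioid.unit huβ
    rw [ModelFrobenioid.unit_comp, hu'.1, ModelFrobenioid.map_id_apply_B, hN] at h
    exact mul_left_cancel (h.trans (mul_one _).symm)
  have hdiv : ModelFrobenioid.div u.hom ^ (N : ℕ) = 1 := by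
    have h := congrArg ModelFrobenioid.div huβ
    rw [ModelFrobenioid.div_comp, hu'.1, ModelFrobenioid.map_id_apply_Φ, hN, hβ, one_mul] at h
    exact h
  exact S.tf.pow_eq_one_of_mem_units hu' hdiv hunit

/-- `RootUnitTorsion` — `_holds` alias of `rootUnitTorsion_holds` above under the fact's exact name (appended
2026-08-28, D-0026 bookkeeping: the proof term is the existing theorem of this file; no statement,
definition or attribute is edited; no new named fact; the ledger's debt table listed the fact
unproved). [cite: MochizukiEtTh2009, Prop 4.2 p.89] -/
theorem _root_.Literature.AnabelianGeometry.EtaleTheta.BiKummerSetting.Prop42Sub.RootUnitTorsion_holds :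
    Literature.AnabelianGeometry.EtaleTheta.BiKummerSetting.Prop42Sub.RootUnitTorsion S pullFrac :=
  _root_.Literature.AnabelianGeometry.EtaleTheta.BiKummerSetting.Prop42Sub.rootUnitTorsion_holds (S := S) (pullFrac := pullFrac)

end Prop42Sub

end BiKummerSetting

end Literature.AnabelianGeometry.EtaleTheta
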